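import Mathlib.MeasureTheory.Measure.Haar.Basic
import Mathlib.MeasureTheory.Group.Integral
import Mathlib.MeasureTheory.Function.L2Space
import Mathlib.Analysis.InnerProductSpace.Orthonormal
import Mathlib.Analysis.Complex.Circle
import Mathlib.Algebra.Group.AddChar
import Mathlib.Topology.ContinuousMap.StoneWeierstrass
import Mathlib.MeasureTheory.Measure.OpenPos
import Mathlib.MeasureTheory.Integral.Bochner.ContinuousLinearMap
import HarnessLib

/-!
# Characters of compact abelian groups: orthogonality, Bessel's inequality, completeness

Trunk `AutomorphicAxiomatic` (G19), topic `NumberTheory/Automorphic`; namespace `Literature.Automorphic`.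
Abstract harmonic analysis (Mathlib only) for the global Fourier analysis of automorphic forms on
the compact groups `(𝔸_K ⧸ K)^m ≅ U(K) \ U(𝔸)` (abelian unipotent quotients), with the characters
`ψ_η = ψ_K(η · x)`, `η ∈ K^m`, of `AdelicAdditiveCharacter` / `AdelicAdditiveCharacterDuality`:

* `integral_addChar_eq_zero` — a character `χ : AddChar C Circle` which is not identically `1` has
  `∫ χ dμ = 0` for every left-invariant measure `μ` (`∫ χ = χ(a) ∫ χ`);
* `integral_conj_addChar_mul_addChar` — **orthogonality relations** `∫ conj(χ) χ' dμ = δ_{χ,χ'}`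
  for an invariant probability measure;
* `orthonormal_addCharLp` — an injective family of continuous characters is orthonormal in
  `L²(C, μ)` (their classes `addCharLp`), whence **Bessel's inequality**
  `Σ_i |∫ conj(χ_i) f dμ|² ≤ ∫ |f|² dμ` for `f ∈ L²` in three forms
  (`tsum_norm_sq_integral_conj_addChar_mul_le`, `summable_norm_sq_integral_conj_addChar_mul`,
  `sum_norm_sq_integral_conj_addChar_mul_le`; Mathlib `Orthonormal.tsum_inner_products_le`);
* `eq_zero_of_forall_integral_addChar_mul_eq_zero` — **completeness**: if a group `S` of
  continuous characters separates points of the compact group `C` and `μ` is a finite measure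
  positive on non-empty open sets, a continuous `f` with `∫ χ f dμ = 0` for all `χ ∈ S` vanishes
  identically (Stone–Weierstrass for the star subalgebra spanned by `S`, Mathlib
  `ContinuousMap.starSubalgebra_topologicalClosure_eq_top_of_separatesPoints`, applied to the
  continuous functional `integralAgainst μ f`).

The remaining standard input — invariance of the Haar probability measure of a compact group under
continuous automorphisms — is Mathlib's `AddMonoidHom.measurePreserving`
(`Mathlib.MeasureTheory.Measure.Haar.Unique`). Mathlib has orthogonality of `AddChar`s of *finite*
groups (`AddChar.sum_eq_zero_of_ne_one` etc.) and the Fourier basis of `AddCircle`, but not the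
compact-group statements above (`lean search 'integral_addChar|orthonormal_addChar'`: no hits).

## References

* A. Weil, *L'intégration dans les groupes topologiques et ses applications* (1940), §§27–28;
  A. Deitmar, S. Echterhoff, *Principles of Harmonic Analysis* (2014), Ch. 3 and Thm. 13.3.7
  (held copy, the `𝔸/ℚ` duality this file is used with). All statements are classical; tagged
  folklore.
-/

open MeasureTheory Complex
open scoped ComplexConjugate

namespace Literature.NumberTheory.Automorphic

noncomputable section

section CharacterOrthogonality

variable {C : Type*} [AddCommGroup C] [MeasurableSpace C] (μ : Measure C)

section Vanishing

variable [MeasurableAdd C] [μ.IsAddLeftInvariant]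

/-- **A non-trivial character has integral zero** against an invariant probability measure
(translation invariance gives `∫ χ = χ(a) ∫ χ`). [folklore] -/
theorem integral_addChar_eq_zero (χ : AddChar C Circle) {a : C} (ha : χ a ≠ 1) :
    ∫ x, (χ x : ℂ) ∂μ = 0 := by
  have h := integral_add_left_eq_self (μ := μ) (fun x => (χ x : ℂ)) a
  simp only [AddChar.map_add_eq_mul, Circle.coe_mul] at h
  rw [integral_const_mul] at h
  have hne : (χ a : ℂ) - 1 ≠ 0 := by
    rwa [sub_ne_zero, ne_eq, Circle.coe_eq_one]
  have : ((χ a : ℂ) - 1) * ∫ x, (χ x : ℂ) ∂μ = 0 := by rw [sub_mul, one_mul, h, sub_self]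
  exact (mul_eq_zero.1 this).resolve_left hne

/-- **Orthogonality of characters**: `∫ conj(χ) χ' dμ = 0` for distinct characters `χ ≠ χ'`, and
`= 1` for `χ = χ'`. [folklore] -/
theorem integral_conj_addChar_mul_addChar [IsProbabilityMeasure μ]
    [DecidableEq (AddChar C Circle)] (χ χ' : AddChar C Circle) :
    ∫ x, conj (χ x : ℂ) * (χ' x : ℂ) ∂μ = if χ = χ' then 1 else 0 := by
  -- `conj χ · χ'` is the character `χ' - χ` (pointwise `χ' / χ`)
  have hconj : ∀ x, conj (χ x : ℂ) * (χ' x : ℂ) = ((χ' - χ) x : ℂ) := by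
    intro x
    rw [AddChar.sub_apply', Circle.coe_div, ← Circle.coe_inv_eq_conj, Circle.coe_inv, mul_comm,
      div_eq_mul_inv]
  simp_rw [hconj]
  split_ifs with h
  · subst h
    simp
  · -- `χ' - χ ≠ 1`: pick `a` with `(χ' - χ) a ≠ 1`
    have hne : χ' - χ ≠ 0 := sub_ne_zero.2 (Ne.symm h)
    obtain ⟨a, ha⟩ : ∃ a, (χ' - χ) a ≠ 1 := by
      by_contra hall
      simp only [not_exists, not_not] at hall
      exact hne (AddChar.eq_zero_iff.2 hall)
    exact integral_addChar_eq_zero μ (χ' - χ) ha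

end Vanishing

section L2

variable [TopologicalSpace C] [OpensMeasurableSpace C] [IsProbabilityMeasure μ]

/-- A continuous unitary character is in `L²` of a probability measure. [folklore] -/
theorem memLp_addChar {χ : AddChar C Circle} (hχ : Continuous fun x => (χ x : ℂ)) :
    MemLp (fun x => (χ x : ℂ)) 2 μ :=
  MemLp.of_bound hχ.aestronglyMeasurable 1 (Filter.Eventually.of_forall fun x => by simp)

/-- The `L²`-class of a continuous unitary character. [folklore] -/
def addCharLp {χ : AddChar C Circle} (hχ : Continuous fun x => (χ x : ℂ)) : Lp ℂ 2 μ :=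
  (memLp_addChar μ hχ).toLp _

/-- The class `addCharLp` is represented by the character. [folklore] -/
theorem coeFn_addCharLp {χ : AddChar C Circle} (hχ : Continuous fun x => (χ x : ℂ)) :
    (addCharLp μ hχ : C → ℂ) =ᵐ[μ] fun x => (χ x : ℂ) :=
  MemLp.coeFn_toLp _

variable [MeasurableAdd C] [μ.IsAddLeftInvariant]

/-- **Distinct continuous characters are orthonormal in `L²(C, μ)`** for an invariant probability
measure `μ`. [folklore] -/
theorem orthonormal_addCharLp {ι : Type*} {χ : ι → AddChar C Circle} (hinj : Function.Injective χ)
    (hχ : ∀ i, Continuous fun x => (χ i x : ℂ)) :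
    Orthonormal ℂ fun i => addCharLp μ (hχ i) := by
  classical
  rw [orthonormal_iff_ite]
  intro i j
  rw [MeasureTheory.L2.inner_def]
  have : (fun a => inner ℂ ((addCharLp μ (hχ i) : C → ℂ) a) ((addCharLp μ (hχ j) : C → ℂ) a)) =ᵐ[μ]
      fun a => conj (χ i a : ℂ) * (χ j a : ℂ) := by
    filter_upwards [coeFn_addCharLp μ (hχ i), coeFn_addCharLp μ (hχ j)] with a ha hb
    rw [ha, hb, RCLike.inner_apply']
  rw [integral_congr_ae this, integral_conj_addChar_mul_addChar μ]
  simp only [hinj.eq_iff]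

omit [MeasurableAdd C] [μ.IsAddLeftInvariant] in
/-- The inner product of the class of a character with the class of `f ∈ L²`:
`⟪χ, f⟫ = ∫ conj(χ) f dμ`. [folklore] -/
theorem inner_addCharLp_toLp {χ : AddChar C Circle} (hχ : Continuous fun x => (χ x : ℂ))
    {f : C → ℂ} (hf : MemLp f 2 μ) :
    inner ℂ (addCharLp μ hχ) (hf.toLp f) = ∫ x, conj (χ x : ℂ) * f x ∂μ := by
  rw [MeasureTheory.L2.inner_def]
  refine integral_congr_ae ?_
  filter_upwards [coeFn_addCharLp μ hχ, hf.coeFn_toLp] with a ha hb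
  rw [ha, hb, RCLike.inner_apply']

omit [AddCommGroup C] [TopologicalSpace C] [OpensMeasurableSpace C] [IsProbabilityMeasure μ]
  [MeasurableAdd C] [μ.IsAddLeftInvariant] in
/-- `‖f‖²_{L²} = ∫ ‖f‖² dμ` for the class of `f`. [folklore] -/
theorem norm_toLp_sq {f : C → ℂ} (hf : MemLp f 2 μ) :
    ‖hf.toLp f‖ ^ 2 = ∫ x, ‖f x‖ ^ 2 ∂μ := by
  rw [@norm_sq_eq_re_inner ℂ, MeasureTheory.L2.inner_def]
  have : (fun a => inner ℂ ((hf.toLp f : C → ℂ) a) ((hf.toLp f : C → ℂ) a)) =ᵐ[μ]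
      fun a => ((‖f a‖ ^ 2 : ℝ) : ℂ) := by
    filter_upwards [hf.coeFn_toLp] with a ha
    rw [ha, inner_self_eq_norm_sq_to_K]
    norm_cast
  rw [integral_congr_ae this, integral_complex_ofReal]
  exact Complex.ofReal_re _

/-- **Bessel's inequality for characters.** For `f ∈ L²(C, μ)` and an injective family of
continuous characters `χ_i`: `Σ_i |∫ conj(χ_i) f dμ|² ≤ ∫ |f|² dμ` (and the series converges).
[folklore] -/
theorem tsum_norm_sq_integral_conj_addChar_mul_le {ι : Type*} {χ : ι → AddChar C Circle}
    (hinj : Function.Injective χ) (hχ : ∀ i, Continuous fun x => (χ i x : ℂ))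
    {f : C → ℂ} (hf : MemLp f 2 μ) :
    ∑' i, ‖∫ x, conj (χ i x : ℂ) * f x ∂μ‖ ^ 2 ≤ ∫ x, ‖f x‖ ^ 2 ∂μ := by
  have h := (orthonormal_addCharLp μ hinj hχ).tsum_inner_products_le (hf.toLp f)
  simp_rw [inner_addCharLp_toLp μ _ hf] at h
  rwa [norm_toLp_sq μ hf] at h

/-- Summability in Bessel's inequality for characters. [folklore] -/
theorem summable_norm_sq_integral_conj_addChar_mul {ι : Type*} {χ : ι → AddChar C Circle}
    (hinj : Function.Injective χ) (hχ : ∀ i, Continuous fun x => (χ i x : ℂ))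
    {f : C → ℂ} (hf : MemLp f 2 μ) :
    Summable fun i => ‖∫ x, conj (χ i x : ℂ) * f x ∂μ‖ ^ 2 := by
  have h := (orthonormal_addCharLp μ hinj hχ).inner_products_summable (hf.toLp f)
  simp_rw [inner_addCharLp_toLp μ _ hf] at h
  exact h

/-- Finite form of Bessel's inequality for characters (no summability needed). [folklore] -/
theorem sum_norm_sq_integral_conj_addChar_mul_le {ι : Type*} {χ : ι → AddChar C Circle}
    (hinj : Function.Injective χ) (hχ : ∀ i, Continuous fun x => (χ i x : ℂ))
    {f : C → ℂ} (hf : MemLp f 2 μ) (s : Finset ι) :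
    ∑ i ∈ s, ‖∫ x, conj (χ i x : ℂ) * f x ∂μ‖ ^ 2 ≤ ∫ x, ‖f x‖ ^ 2 ∂μ := by
  have h := (orthonormal_addCharLp μ hinj hχ).sum_inner_products_le (s := s) (hf.toLp f)
  simp_rw [inner_addCharLp_toLp μ _ hf] at h
  rwa [norm_toLp_sq μ hf] at h

end L2

end CharacterOrthogonality

section Completeness

variable {C : Type*} [AddCommGroup C] [TopologicalSpace C]

/-- The continuous function underlying a continuous character. [folklore] -/
def addCharContinuousMap (χ : AddChar C Circle) (hχ : Continuous fun x => (χ x : ℂ)) : C(C, ℂ) :=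
  ⟨fun x => (χ x : ℂ), hχ⟩

/-- Unfolding of `addCharContinuousMap`. [folklore] -/
@[simp] theorem addCharContinuousMap_apply (χ : AddChar C Circle)
    (hχ : Continuous fun x => (χ x : ℂ)) (x : C) : addCharContinuousMap χ hχ x = (χ x : ℂ) := rfl

variable [CompactSpace C] [MeasurableSpace C] [OpensMeasurableSpace C] (μ : Measure C)
  [IsFiniteMeasure μ]

/-- Integration against a fixed continuous `f` as a continuous linear functional on `C(C, ℂ)`
(bound `∫ ‖f‖ dμ`). [folklore] -/
def integralAgainst (f : C(C, ℂ)) : C(C, ℂ) →L[ℂ] ℂ :=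
  LinearMap.mkContinuous
    { toFun := fun g => ∫ x, g x * f x ∂μ
      map_add' := fun g g' => by
        simp only [ContinuousMap.add_apply, add_mul]
        exact integral_add ((g.continuous.mul f.continuous).integrable_of_hasCompactSupport
          (HasCompactSupport.of_compactSpace _))
          ((g'.continuous.mul f.continuous).integrable_of_hasCompactSupport
          (HasCompactSupport.of_compactSpace _))
      map_smul' := fun c g => by
        simp only [ContinuousMap.smul_apply, smul_eq_mul, mul_assoc, RingHom.id_apply]
        exact integral_const_mul c _ }
    (∫ x, ‖f x‖ ∂μ) fun g => by
      simp only [LinearMap.coe_mk, AddHom.coe_mk]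
      calc ‖∫ x, g x * f x ∂μ‖ ≤ ∫ x, ‖g x * f x‖ ∂μ := norm_integral_le_integral_norm _
        _ ≤ ∫ x, ‖g‖ * ‖f x‖ ∂μ := by
            refine integral_mono_of_nonneg (Filter.Eventually.of_forall fun x => norm_nonneg _)
              ((f.continuous.norm.integrable_of_hasCompactSupport
                (HasCompactSupport.of_compactSpace _)).const_mul _)
              (Filter.Eventually.of_forall fun x => ?_)
            change ‖g x * f x‖ ≤ ‖g‖ * ‖f x‖
            rw [norm_mul]
            exact mul_le_mul_of_nonneg_right (g.norm_coe_le_norm x) (norm_nonneg _)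
        _ = (∫ x, ‖f x‖ ∂μ) * ‖g‖ := by rw [integral_const_mul, mul_comm]

omit [AddCommGroup C] in
/-- Unfolding of `integralAgainst`. [folklore] -/
theorem integralAgainst_apply (f g : C(C, ℂ)) : integralAgainst μ f g = ∫ x, g x * f x ∂μ :=
  rfl

variable [μ.IsOpenPosMeasure]

/-- **Completeness of characters (injectivity of the Fourier transform on a compact group).**
Let `S` be a group of continuous unitary characters of the compact group `C` separating points
(`∀ x ≠ 0, ∃ χ ∈ S, χ x ≠ 1`), and `μ` a finite measure positive on non-empty open sets (e.g. Haar).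
If a continuous `f : C → ℂ` satisfies `∫ χ · f dμ = 0` for every `χ ∈ S`, then `f = 0`.
Proof: the `ℂ`-span of `S` is a star subalgebra of `C(C, ℂ)` separating points, hence dense
(Stone–Weierstrass); integration against `f` is a continuous linear functional vanishing on it,
hence on `conj f`, so `∫ |f|² = 0`. [folklore] -/
theorem eq_zero_of_forall_integral_addChar_mul_eq_zero (S : AddSubgroup (AddChar C Circle))
    (hS : ∀ χ ∈ S, Continuous fun x => (χ x : ℂ))
    (hsep : ∀ x : C, x ≠ 0 → ∃ χ ∈ S, χ x ≠ 1) {f : C → ℂ} (hf : Continuous f)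
    (h : ∀ χ ∈ S, ∫ x, (χ x : ℂ) * f x ∂μ = 0) : f = 0 := by
  classical
  set F : C(C, ℂ) := ⟨f, hf⟩ with hF
  -- the characters as a submonoid of `C(C, ℂ)`
  set S' : Set C(C, ℂ) := {g | ∃ χ, ∃ hχ : χ ∈ S, g = addCharContinuousMap χ (hS χ hχ)} with hS'
  have hS'mul : ∀ g ∈ S', ∀ g' ∈ S', g * g' ∈ S' := by
    rintro _ ⟨χ, hχ, rfl⟩ _ ⟨χ', hχ', rfl⟩
    refine ⟨χ + χ', S.add_mem hχ hχ', ?_⟩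
    ext x
    simp [AddChar.add_apply]
  have hS'one : (1 : C(C, ℂ)) ∈ S' := ⟨0, S.zero_mem, by ext x; simp⟩
  have hS'star : ∀ g ∈ S', star g ∈ S' := by
    rintro _ ⟨χ, hχ, rfl⟩
    refine ⟨-χ, S.neg_mem hχ, ?_⟩
    ext x
    simp only [ContinuousMap.star_apply, addCharContinuousMap_apply, AddChar.neg_apply',
      Circle.coe_inv_eq_conj]
    rfl
  let M : Submonoid C(C, ℂ) :=
    { carrier := S'
      one_mem' := hS'one
      mul_mem' := fun {g g'} hg hg' => hS'mul g hg g' hg' }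
  -- the functional vanishes on `S'`, hence on its span, which is the star subalgebra it generates
  set Φ := integralAgainst μ F with hΦ
  have hΦS' : ∀ g ∈ S', Φ g = 0 := by
    rintro _ ⟨χ, hχ, rfl⟩
    rw [integralAgainst_apply]
    exact h χ hχ
  set A := StarAlgebra.adjoin ℂ S' with hA
  have hclosure : Submonoid.closure (S' ∪ star S') ≤ M := by
    rw [Submonoid.closure_le]
    rintro g (hg | hg)
    · exact hg
    · obtain ⟨g', hg', rfl⟩ : ∃ g' ∈ S', star g' = g := by
        rw [Set.mem_star] at hg
        exact ⟨star g, hg, star_star g⟩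
      exact hS'star g' hg'
  have hΦA : ∀ g ∈ A, Φ g = 0 := by
    intro g hg
    have hg' : g ∈ Subalgebra.toSubmodule (Algebra.adjoin ℂ (S' ∪ star S')) := by
      rw [← StarAlgebra.adjoin_toSubalgebra]; exact hg
    rw [Algebra.adjoin_eq_span] at hg'
    refine Submodule.span_induction (p := fun g _ => Φ g = 0) ?_ ?_ ?_ ?_ hg'
    · intro g hg; exact hΦS' g (hclosure hg)
    · exact map_zero Φ
    · intro g g' _ _ hg hg'; rw [map_add, hg, hg', add_zero]
    · intro c g _ hg; rw [map_smul, hg, smul_zero]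
  -- `A` separates points, hence is dense
  have hAsep : A.SeparatesPoints := by
    intro x y hxy
    obtain ⟨χ, hχ, hne⟩ := hsep (x - y) (sub_ne_zero.2 hxy)
    refine ⟨_, ⟨addCharContinuousMap χ (hS χ hχ), ?_, rfl⟩, ?_⟩
    · exact StarAlgebra.subset_adjoin ℂ _ ⟨χ, hχ, rfl⟩
    · simp only [addCharContinuousMap_apply, ne_eq, Circle.coe_inj]
      intro hxy'
      apply hne
      have : χ x = χ (x - y) * χ y := by rw [← AddChar.map_add_eq_mul, sub_add_cancel]
      rw [hxy'] at this
      exact (mul_eq_right.1 this.symm)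
  have hdense : A.topologicalClosure = ⊤ :=
    ContinuousMap.starSubalgebra_topologicalClosure_eq_top_of_separatesPoints A hAsep
  -- so `Φ` vanishes identically, in particular on `conj f`
  have hΦall : ∀ g : C(C, ℂ), Φ g = 0 := by
    intro g
    have hg : g ∈ (A.topologicalClosure : Set C(C, ℂ)) := by
      rw [hdense]; exact StarSubalgebra.mem_top
    rw [StarSubalgebra.topologicalClosure_coe] at hg
    -- `Φ⁻¹ {0}` is closed and contains `A`
    have hclosed : IsClosed {g : C(C, ℂ) | Φ g = 0} := isClosed_eq Φ.continuous continuous_const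
    exact (hclosed.closure_subset_iff.2 fun g hg => hΦA g hg) hg
  -- apply to `conj f`: `∫ |f|² = 0`
  have h0 : ∫ x, ‖f x‖ ^ 2 ∂μ = 0 := by
    have := hΦall (star F)
    rw [integralAgainst_apply] at this
    have hint : (fun x => (star F) x * F x) = fun x => ((‖f x‖ ^ 2 : ℝ) : ℂ) := by
      funext x
      simp only [ContinuousMap.star_apply, hF, ContinuousMap.coe_mk, RCLike.star_def,
        Complex.conj_mul', Complex.ofReal_pow]
    rw [hint, integral_complex_ofReal, Complex.ofReal_eq_zero] at this
    exact this
  -- hence `f = 0`: the integrand is continuous and non-negative, `μ` is positive on open sets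
  have hnn : 0 ≤ fun x => ‖f x‖ ^ 2 := fun x => by positivity
  have hint : Integrable (fun x => ‖f x‖ ^ 2) μ :=
    ((hf.norm.pow 2).integrable_of_hasCompactSupport (HasCompactSupport.of_compactSpace _))
  have hae := (integral_eq_zero_iff_of_nonneg hnn hint).1 h0
  have heq : (fun x => ‖f x‖ ^ 2) = fun _ => (0 : ℝ) :=
    ((hf.norm.pow 2).ae_eq_iff_eq μ continuous_const).1 hae
  funext x
  have := congrFun heq x
  simp only [ne_eq, OfNat.ofNat_ne_zero, not_false_eq_true, pow_eq_zero_iff, norm_eq_zero] at this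
  exact this

end Completeness

end

end Literature.NumberTheory.Automorphic
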